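import Summits.BirchSwinnertonDyer.Rank1Residual.ManinAdditive.UDCKummerWitnessLine
import Literature.NumberTheory.EllipticCurves.ModularCurveCoordinateRationality
import HarnessLib
import HarnessLib.Audit.Tags

/-!
# UDC Kummer witness line — ADDENDUM: the B-LINE (a rational modular form kills the poles) (T-an-45)

TYPER NOTE (typer g20, T-an-45).  SOURCE = HOME/an/g38/UDCKummerWitnessLineB-an-g38.lean sha16 78a9702a0ebb48d4 (157 l.; an: farm rc 0 · 0 err · 0 warn ·
0 s∗rry; statements byte-identical to an's v3 06dbf107 §3B/§4B, BC7 14/14 CLEAN g38-bc7-wl.out 8eebebe93fc728bd; glue vs landed names ByName82d-g38.lean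
ef86ff2eec39a57c rc 0) VERBATIM except this note.  Statement-only ADDENDUM to the landed `UDCKummerWitnessLine.lean` (p729921) in the same namespace:
five plain `def … : Prop` pieces (RATDESC) `RationalModularFunctionDescent` · (RATB) `KummerMinimalParamPresentation` · (HOLB) `KummerMinimalWitnessExtensionB` ·
(QEXNB) `IntegralQSeriesNearCuspB` · (INVB) `KummerMinimalWitnessInvarianceB` (an: theorems on paper over the tree, [folklore]; refuter ref1 §R174
ADDENDUM: all five TRUE AS TYPED, (INVB) ⟸ needs exactly `B_d ≠ 0 ∧ C₀ ≠ 0`; the typer has not re-audited them) and two pure-logic compositions onto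
the landed research nodes (WL♭)/(WL) — NO new conjecture node, so no `@[conjecture]` here.  (RATDESC) is the σ-idiom spelling; the C3 LEAD's
coefficientwise version lives Theorems-side (`Theorems/ManinLocalTwoThreeRationalDescent.lean`, p729755) — different statements, no dedup.  Typer
checks: decl names fresh in the tree; imports = landed `…ManinAdditive.UDCKummerWitnessLine` + `Literature.NumberTheory.EllipticCurves.ModularCurveCoordinateRationality`
(Theses-free); no instances, no notation; own farm check rc 0 · 0 warnings.  With the typer's companion `UDCKummerWitnessLineHolds.lean` (p730253:
`qExpansionExtensionPrinciple_holds`, `kummerCubeRootCongruenceOfBoundedOfUDC_of_nearCusp`) the B-line reads (INT)(DICT)(RATB)(HOLB)(QEXNB)(INVB) ⟹ (WL♭)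
⟹ (WL) and ⟹ (AN♮) with (QXP) discharged.  PARTITION 3 · beyond-print theorem: no (typed statements; engines in print: Shimura 1971 §2/§6, Borel AG §14.2,
DS05 §7.5) · bears_on stmt-BirchSwinnertonDyer-22968 (C3; fallback for (EXT) in LEAD's v25) · BSD is not proved by this; (WL♭), (WL), C3 OPEN.

Cell bsd-f2-manin, seat -an g38 (analytic / period-lattice lens), 2026-08-29.  Addendum to the landed
`Summits/BirchSwinnertonDyer/Rank1Residual/ManinAdditive/UDCKummerWitnessLine.lean` (p729921, = HOME/an/g38 v2 d69c9f2f9468a99d): the five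
B-LINE pieces and their PROVED composition to the relaxed witness law (WL♭) `KummerCubeRootModularFormWitnessNearCusp` of the C3 UDC line
(route ManinLocalTwoThree, crux C3 = `ManinPrimeToThreeAtNine`, stmt-22968; C3 LEAD skeleton v25 uses the P(j)-line of the base module and names
this B-line the FALLBACK for (EXT)).  Architecture = p2's design note (STATUS 2026-08-29T15:35:06Z), moved to the MINIMAL model.

Instead of the integer polynomial `P(j)` of (ALG)/(EXT), kill the poles of `t_W∘φ` by a Γ₀(N)-form with INTEGER `q`-expansion obtained from the
function field: `ℂ(X₀(N)) = K_N = ℂ(v₁,…,v₈)` (`modularFunctionField N`, `coordFn N i = mᵢ/Δ`, tree `exists_polyJ_smul_mem_intClosureJ`,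
`exists_mul_aeval_eq_aeval`), the `vᵢ` have rational expansions (`mapLaurent_coordFn`), and an `Aut(ℂ)`-fixed `h ∈ K_N` is `p(v)/q(v)` with
`p, q ∈ ℚ[v]` — (RATDESC) `RationalModularFunctionDescent`, a THEOREM over the tree (stable-subspace descent
`Complex.submodule_le_span_fixed_of_forall_ringEquiv` [Borel AG §14.2] + `exists_ratCast_eq_of_forall_ringEquiv`; the C3 LEAD's coefficientwise
linear-algebra version is `Theorems/ManinLocalTwoThreeRationalDescent.lean`, p729755), NOT a print input.  Applied to `h = t_W∘φ` (rational expansion: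
`mapLaurent_xFn` and its `y`-analogue) and clearing denominators: `B_d := D·q(v)Δ^d`, `B_n := D·c·p(v)Δ^d ∈ M_{12d}(Γ₀(N)) ∩ ℤ⟦q⟧` with
`B_d·(c·t_W∘φ) = B_n` — (RATB) `KummerMinimalParamPresentation`.  The witness is `F = κ·B_d·(c·t_W∘φ)·W_{u,e}(c·ℰ_f) = κ·B_n·W` in weight `12d`:
NO pole-order bookkeeping and NO `j`-algebraicity ((HOLB) `KummerMinimalWitnessExtensionB`: removable singularities on `φ⁻¹(O) ∪ φ⁻¹{y_W = 0}` +
cusp growth by p2's cube trick `(t_W·W)³ ∈ K_N` — cf. p2's landed AN2-d `KummerCubeRootDictionary.exists_mdifferentiable_extension` (p729873) and AN2-e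
`exists_growth_slash`, both generic in the pair `(B, B′)`; (QEXNB) `IntegralQSeriesNearCuspB`: Cauchy product with `B_d ∈ ℤ⟦q⟧` — cf. the LEAD's
`IntegralQSeries` file p730250; (INVB) `KummerMinimalWitnessInvarianceB`: p2's AN2-c p728257 + the LEAD's `WitnessSlashAlgebra.mul_slash_eq_self_iff`
p729721, `B_d ≠ 0`).  The model point stands: the `q`-series factor must be the MINIMAL-model `g = ρ⁻¹h ∈ ℤ⟦q⟧` of (INT) (p3 p728452: the
short-model `h` has unbounded `2`-power denominators), i.e. `t_W`, not `t_s`.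
PROVED (pure logic): `kummerCubeRootModularFormWitnessNearCusp_of_piecesB : (INT) → (DICT) → (RATB) → (HOLB) → (QEXNB) → (INVB) → (WL♭)` and
`kummerCubeRootModularFormWitness_of_piecesB : … → (QXP) → (WL)`.  Truth audit (planner; refuter ref1 §R174 ADDENDUM: all five TRUE AS TYPED, (INVB) `⟸`
needs exactly `B_d ≠ 0 ∧ C₀ ≠ 0`).  PARTITION 3 (typed certificate; BSD is not proved by this; C3 OPEN).  No `sorry`, no new axioms, no
`instance`/`notation`.

References: [Borel1991] A. Borel, *Linear Algebraic Groups*, AG §14.2; [ShimuraIATAF1971] §2.1–2.4, §6.1–6.2; [DiamondShurman2005] §7.5;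
[SilvermanAEC2009] IV.1, VI.3; cell: MEMO-an §81.8, p2 STATUS 2026-08-29T15:35:06Z, C3 LEAD 15:38:51Z/15:51:52Z, ref1 §R174 ADDENDUM.
-/

set_option autoImplicit false

noncomputable section

open PowerSeries CongruenceSubgroup Complex
open scoped MatrixGroups ModularForm PeriodPair UpperHalfPlane Manifold
open WeierstrassCurve Literature.NumberTheory.EllipticCurves Literature.NumberTheory.EllipticCurves.ModularForms
open Summit.BirchSwinnertonDyer.Rank1Residual.ManinAdditive.CuspidalKummer
open Summit.BirchSwinnertonDyer.Rank1Residual.ManinAdditive.CuspidalKummerThree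
open Summit.BirchSwinnertonDyer.Rank1Residual.ManinAdditive.KummerCubeMonodromy
open Summit.BirchSwinnertonDyer.Rank1Residual.ManinAdditive.UDCKummerLine

namespace Summit.BirchSwinnertonDyer.Rank1Residual.ManinAdditive.UDCKummerWitnessLine

variable {W : WeierstrassCurve ℚ} {N : ℕ} [NeZero N]

/-! ## §3B The B-line pieces (rational modular form as pole killer) -/

/-- **(RATDESC) rational descent in the modular function field (GENERIC support; a THEOREM over the tree, feeds (RATB))**: an element of
`K_N = modularFunctionField N ⊆ ℂ((q))` fixed coefficientwise by every automorphism of `ℂ` is `p(v)/q(v)` with `p, q ∈ ℚ[v₁,…,v₈]`, `q(v) ≠ 0`.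
Plan by name: `h = b/a(j)`, `b ∈ B` (`exists_polyJ_smul_mem_intClosureJ`), `b·q₀(v) = p₀(v)` (`mem_pointPlace_of_mem_intClosureJ`,
`exists_mul_aeval_eq_aeval`), so `h ∈ ℂ(v)`; the space of relations `{(p, q) ∈ ℂ[v]_{≤d}² : h·q(v) = p(v)}` is an `Aut(ℂ)`-stable subspace of a
coordinate space (`mapLaurent_aeval`, `mapLaurent_coordFn`), hence spanned by rational vectors (`Complex.submodule_le_span_fixed_of_forall_ringEquiv`,
`F = ℚ`; `exists_ratCast_eq_of_forall_ringEquiv`), and the linear map `(p, q) ↦ q(v)` is non-zero on it, so on some rational vector. [folklore] -/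
def RationalModularFunctionDescent : Prop :=
  ∀ {N : ℕ} [NeZero N] (h : modularFunctionField N),
    (∀ σ : ℂ ≃+* ℂ, mapLaurent (σ : ℂ →+* ℂ) (h : LaurentSeries ℂ) = h) →
    ∃ p q : MvPolynomial (Fin 8) ℚ,
      MvPolynomial.aeval (coordFn N) (MvPolynomial.map (algebraMap ℚ ℂ) q) ≠ 0 ∧
      h * MvPolynomial.aeval (coordFn N) (MvPolynomial.map (algebraMap ℚ ℂ) q) =
        MvPolynomial.aeval (coordFn N) (MvPolynomial.map (algebraMap ℚ ℂ) p)

/-- **(RATB) integral modular presentation of the minimal parameter along `φ`**: there are `m` and Γ₀(N)-modular forms `B_n, B_d ≠ 0` of weight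
`12m`, `B_d` with INTEGER `q`-expansion, with `B_d·(c·t_W∘φ) = B_n` off `φ⁻¹(O) ∪ φ⁻¹{y_W = 0}` ((RATDESC) for `t_W∘φ ∈ K_N`, whose expansion is
rational by `mapLaurent_xFn` / the `y`-analogue; `B_d = D·q(v)Δ^d`, `B_n = D·c·p(v)Δ^d`, `mᵢ, Δ ∈ ℤ⟦q⟧`; values by the evaluation dictionary
`IsXPresentation.apply_eq_mul`). [folklore] -/
def KummerMinimalParamPresentation : Prop :=
  ∀ (W : WeierstrassCurve ℚ) [W.IsElliptic] [W.IsGloballyMinimal] {N : ℕ} [NeZero N]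
    (D : ModularParametrizationData W N) (a : ℕ → ℤ), (∀ n, (a n : ℂ) = cuspCoeff D.f n) →
    ∃ (m : ℕ) (Bn Bd : ModularForm (Gamma0 N) (12 * (m : ℤ))) (bd : ℕ → ℤ), Bd ≠ 0 ∧
      (∀ τ : ℍ, HasSum (fun n : ℕ ↦ (bd n : ℂ) * Complex.exp (2 * Real.pi * Complex.I * (τ : ℂ) * n)) (Bd τ)) ∧
      ∀ τ : ℍ, (D.c : ℂ) * eichlerIntegral D.f τ ∉ D.L.lattice → minimalY D τ ≠ 0 →
        Bd τ * minimalParam D τ = Bn τ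

/-- **(HOLB) holomorphic extension, B-version** (p2's AN2-d/e on the minimal model): `C₀·B_d·(t_W∘φ)·W = C₀·B_n·W` off `φ⁻¹{y_W = 0}` and
`C₀·B_d·((t_W∘φ)·W)` near `φ⁻¹(O)` (simple zero × simple pole, both of order `e_φ`) — so the product extends to a holomorphic `F` on `ℍ`; at a cusp
`g·∞`: `((t_W∘φ)·W)³∘g` is the value of an element of `K_N` (`W³` is elliptic), a ratio of slashed modular forms, hence `≤ Ce^{M·Im τ}`, and `B_d∣g`
is bounded. [folklore] -/
def KummerMinimalWitnessExtensionB : Prop :=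
  ∀ (W : WeierstrassCurve ℚ) [W.IsElliptic] [W.IsGloballyMinimal] {N : ℕ} [NeZero N]
    (D : ModularParametrizationData W N) (u : ℂ), u ∉ D.L.lattice →
    ∀ m₁ m₂ : ℤ, 3 * u = m₁ * D.L.ω₁ + m₂ * D.L.ω₂ →
    ∀ (m : ℕ) (Bn Bd : ModularForm (Gamma0 N) (12 * (m : ℤ))),
      (∀ τ : ℍ, (D.c : ℂ) * eichlerIntegral D.f τ ∉ D.L.lattice → minimalY D τ ≠ 0 →
        Bd τ * minimalParam D τ = Bn τ) →
    ∀ C₀ : ℂ, ∃ F : ℍ → ℂ, MDifferentiable 𝓘(ℂ) 𝓘(ℂ) F ∧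
      (∀ τ : ℍ, (D.c : ℂ) * eichlerIntegral D.f τ ∉ D.L.lattice → minimalY D τ ≠ 0 →
        F τ = C₀ * Bd τ * kummerMinBlock D u (m₁ * D.L.η₁ + m₂ * D.L.η₂) τ) ∧
      (∀ g : SL(2, ℤ), ∃ C A m' : ℝ, ∀ τ : ℍ, A ≤ τ.im →
        ‖(F ∣[(12 * (m : ℤ))] g) τ‖ ≤ C * Real.exp (m' * τ.im))

/-- **(QEXNB) integer `q`-series of the B-witness near the cusp (GENERIC bookkeeping)**: `Φ = Σ gₘq^m` (`g ∈ ℤ⟦q⟧`) for `Im τ > B`,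
`B_d = Σ bₙe^{2πiτn}` (`bₙ ∈ ℤ`) on `ℍ`, `F = B_d·Φ` for `Im τ > B'` ⟹ `F = Σ b'ₘe^{2πiτm}` with `b'ₘ ∈ ℤ` for `Im τ` large (Cauchy product). [folklore] -/
def IntegralQSeriesNearCuspB : Prop :=
  ∀ (Φ F Bd : ℍ → ℂ) (g : ℚ⟦X⟧) (bd : ℕ → ℤ),
    (∀ m, (coeff m g).den = 1) →
    (∃ B : ℝ, ∀ τ : ℍ, B < τ.im → HasSum (fun m : ℕ ↦ ((coeff m g : ℚ) : ℂ) * Function.Periodic.qParam 1 (τ : ℂ) ^ m) (Φ τ)) →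
    (∀ τ : ℍ, HasSum (fun n : ℕ ↦ (bd n : ℂ) * Complex.exp (2 * Real.pi * Complex.I * (τ : ℂ) * n)) (Bd τ)) →
    (∃ B : ℝ, ∀ τ : ℍ, B < τ.im → F τ = Bd τ * Φ τ) →
      ∃ (b : ℕ → ℤ) (B : ℝ), ∀ τ : ℍ, B < τ.im →
        HasSum (fun m : ℕ ↦ (b m : ℂ) * Complex.exp (2 * Real.pi * Complex.I * (τ : ℂ) * m)) (F τ)

/-- **(INVB) the stabiliser of the B-witness is the Kummer group** (p2's AN2-c `forall_gamma_smul_eq_of_kummerPeriodTrivial` / `exists_multiplier_gamma` /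
`kummerPeriodTrivial_of_forall_gamma_smul_eq` for the block, `t_W∘φ` Γ₀(N)-invariant, `B_d ∈ M_{12m}(Γ₀(N))`, identity theorem; `⟸` uses `C₀ ≠ 0`,
`B_d ≠ 0` and block `≢ 0`). [folklore] -/
def KummerMinimalWitnessInvarianceB : Prop :=
  ∀ (W : WeierstrassCurve ℚ) [W.IsElliptic] [W.IsGloballyMinimal] {N : ℕ} [NeZero N]
    (D : ModularParametrizationData W N) (u : ℂ), u ∉ D.L.lattice →
    ∀ m₁ m₂ : ℤ, 3 * u = m₁ * D.L.ω₁ + m₂ * D.L.ω₂ →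
    ∀ (m : ℕ) (Bd : ModularForm (Gamma0 N) (12 * (m : ℤ))), Bd ≠ 0 →
    ∀ C₀ : ℂ, C₀ ≠ 0 → ∀ F : ℍ → ℂ, MDifferentiable 𝓘(ℂ) 𝓘(ℂ) F →
      (∀ τ : ℍ, (D.c : ℂ) * eichlerIntegral D.f τ ∉ D.L.lattice → minimalY D τ ≠ 0 →
        F τ = C₀ * Bd τ * kummerMinBlock D u (m₁ * D.L.η₁ + m₂ * D.L.η₂) τ) →
      ∀ γ : Gamma0 N,
        (KummerPeriodTrivial D u γ → F ∣[(12 * (m : ℤ))] (γ : SL(2, ℤ)) = F) ∧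
        (F ∣[(12 * (m : ℤ))] (γ : SL(2, ℤ)) = F → KummerPeriodTrivial D u γ)

/-! ## §4B The B-line composition (pure logic) -/

/-- **(INT) → (DICT) → (RATB) → (HOLB) → (QEXNB) → (INVB) → (WL♭)**: the witness is `F = κ·B_d·kummerMinBlock` in weight `12m`. -/
theorem kummerCubeRootModularFormWitnessNearCusp_of_piecesB
    (hINT : MinimalKummerCubeRootIntegral) (hDICT : KummerMinimalDictionary) (hRATB : KummerMinimalParamPresentation)
    (hHOLB : KummerMinimalWitnessExtensionB) (hQEXNB : IntegralQSeriesNearCuspB) (hINVB : KummerMinimalWitnessInvarianceB) :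
    KummerCubeRootModularFormWitnessNearCusp := by
  intro W _ _ N _ D a ha _hopt X₀ Y₀ hT u hu h3u hX hY z hz h hh hh0 hbd
  obtain ⟨g, hgint, _hg0, hgrel⟩ := hINT W D a ha X₀ Y₀ hT z hz h hh hh0 hbd
  have h3u' : 3 * u ∈ Submodule.span ℤ {D.L.ω₁, D.L.ω₂} := h3u
  obtain ⟨m₁, m₂, hm⟩ := Submodule.mem_span_pair.mp h3u'
  have hm' : 3 * u = m₁ * D.L.ω₁ + m₂ * D.L.ω₂ := by
    rw [← hm, zsmul_eq_mul, zsmul_eq_mul]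
  obtain ⟨κ, hκ, B, hB⟩ := hDICT W D a ha X₀ Y₀ hT u hu m₁ m₂ hm' hX hY z hz h hh hh0 g hgrel
  obtain ⟨m, Bn, Bd, bd, hBd0, hbd, hid⟩ := hRATB W D a ha
  obtain ⟨F, hFd, hFeq, hFgr⟩ := hHOLB W D u hu m₁ m₂ hm' m Bn Bd hid κ
  refine ⟨12 * (m : ℤ), F, hFd, fun γ hγ ↦ (hINVB W D u hu m₁ m₂ hm' m Bd hBd0 κ hκ F hFd hFeq γ).1 hγ,
    fun γ hγ ↦ (hINVB W D u hu m₁ m₂ hm' m Bd hBd0 κ hκ F hFd hFeq γ).2 hγ, hFgr, ?_⟩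
  refine hQEXNB (fun τ ↦ κ * kummerMinBlock D u (m₁ * D.L.η₁ + m₂ * D.L.η₂) τ) F Bd g bd hgint
    ⟨B, fun τ hτ ↦ (hB τ hτ).2.2⟩ hbd ⟨B, fun τ hτ ↦ ?_⟩
  rw [hFeq τ (hB τ hτ).1 (hB τ hτ).2.1]; ring

/-- **B-line, v23 shape**: `… → (QXP) → (WL)`. -/
theorem kummerCubeRootModularFormWitness_of_piecesB
    (hINT : MinimalKummerCubeRootIntegral) (hDICT : KummerMinimalDictionary) (hRATB : KummerMinimalParamPresentation)
    (hHOLB : KummerMinimalWitnessExtensionB) (hQEXNB : IntegralQSeriesNearCuspB) (hINVB : KummerMinimalWitnessInvarianceB)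
    (hQXP : QExpansionExtensionPrinciple) : KummerCubeRootModularFormWitness :=
  kummerCubeRootModularFormWitness_of_nearCusp
    (kummerCubeRootModularFormWitnessNearCusp_of_piecesB hINT hDICT hRATB hHOLB hQEXNB hINVB) hQXP

end Summit.BirchSwinnertonDyer.Rank1Residual.ManinAdditive.UDCKummerWitnessLine

end
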